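import Summits.ResolutionOfSingularities.ResolutionOfSingularities.Theses.RuledResidues
import Summits.ResolutionOfSingularities.ResolutionOfSingularities.Theorems.RuledResiduesNonRuledDivisorsStubTransportLocal
import Summits.ResolutionOfSingularities.ResolutionOfSingularities.Theorems.RuledResiduesNonRuledDivisorsStubEscapeInjective
import Summits.ResolutionOfSingularities.ResolutionOfSingularities.Theorems.RuledResiduesNonRuledDivisorsStubTransportSingular
import Summits.ResolutionOfSingularities.ResolutionOfSingularities.Theorems.RuledResiduesNonRuledDivisorsStubTransportNonRuled
import Summits.ResolutionOfSingularities.ResolutionOfSingularities.Theorems.RuledResiduesNonRuledCofinite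
import Summits.ResolutionOfSingularities.ResolutionOfSingularities.Theorems.RuledResiduesRegularModelRuled
import Literature.AlgebraicGeometry.Resolution.ResolutionOfSingularities
import HarnessLib

/-!
# A contracted-divisor germ forces `Spec R` to have NO resolution (line `contracted-divisor`,
crux `RuledResidues.NonRuledDivisors`, stmt-ResolutionOfSingularities-18075)

Lead file for the only open stub `stub_contractedDivisorGerm` of the registered line
`Cruxes/NonRuledDivisors/Lines/contracted_divisor.lean`.  The stub asks for a CONTRACTED-DIVISOR GERM:
an affine model `R` of `K/k`, a prime `P` with `R_P` non-regular, a ring automorphism `τ` of `K`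
(semilinear over `ι : k ≃+* k`) inducing a local endomorphism of `R_P`, and ONE discrete valuation ring
`D ⊇ R_P` of `K`, essentially of finite type over `k`, with non-ruled residue field, centred strictly
inside `P` and contracted into `P` by `τ` (`τ P ⊆ 𝔪_D`).  Equivalently: a Kato datum — the germ
`(Spec R, P)` reappears, up to a `k`-semilinear isomorphism of local rings, at a point of a modification
lying on a NON-RULED exceptional divisor.

What is proved here (sorry-free), sharpening "the stub implies the crux":

* `contractedDivisor_witnessSet_infinite` — the data over a FIXED `(k, K, R, P, τ, ι, D)` already make
  the crux's witness set OVER THE SAME MODEL `R` infinite (members `D.comap τⁿ⁺¹`; this is the composition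
  `NonRuledDivisors_of` of the skeleton with `R` kept);
* `not_hasResolution_of_contractedDivisor` — hence `Spec R` admits NO resolution of singularities
  (the route's two kills `NonRuledCofinite` (18076) and `RegularModelRuled` (18077), both PROVED, run at the
  fixed model);
* `contractedDivisor_not_dim_le_three` — so under the named fact `CossartPiltant2019` the model has
  dimension `≥ 4`: the hunt lives in `dim Spec R ≥ 4` (formal version of the Disproof's regime map for
  this line);
* `nonRuledDivisors_of_contractedDivisorGerm` — the registered stub signature, verbatim, implies the crux
  (glue, companion of `nonRuledDivisors_of_orbitGerm`);
* `not_resolutionOfSingularities_of_contractedDivisorGerm` — and refutes the summit outright.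

So any instance of the stub is, formally, a counterexample to resolution of singularities in positive
characteristic for the explicit fourfold-or-higher `Spec R`; this is the precise sense in which the stub
is crux-sized.
-/

noncomputable section

set_option linter.dupNamespace false

open AlgebraicGeometry IsLocalRing
open Literature.AlgebraicGeometry.Resolution
open Summit.ResolutionOfSingularities.ResolutionOfSingularities.Theses.RuledResidues

namespace Summit.ResolutionOfSingularities.ResolutionOfSingularities.Theorems

/-- **Contracted-divisor data make the witness set over the same model infinite.**  For a prime `P`
of the affine model `R ⊆ K` with `R_P` non-regular, a ring automorphism `τ` of `K` semilinear over
`ι : k ≃+* k` inducing a local endomorphism of `R_P`, and a DVR `D ⊇ R_P` of `K` containing `k`,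
essentially of finite type over `k`, contracted into `P` by `τ` (`τ P ⊆ 𝔪_D`), centred strictly inside
`P` (some `s ∈ P` is a `D`-unit) and with non-ruled residue field, the places `D.comap τⁿ⁺¹`, `n : ℕ`,
are pairwise distinct members of the crux's witness set over `R`. [folklore] -/
theorem contractedDivisor_witnessSet_infinite (k K : Type) [Field k] [Field K] [Algebra k K]
    (R : Subalgebra k K) (P : Ideal R.toSubring) [P.IsPrime]
    (hsing : ¬ IsRegularLocalRing (Localization.AtPrime P)) (τ : K ≃+* K) (ι : k ≃+* k)
    (hsemi : ∀ c : k, τ (algebraMap k K c) = algebraMap k K (ι c))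
    (hloc : ∀ r : R.toSubring, ∃ a s : R.toSubring, s ∉ P ∧ τ (r : K) * (s : K) = (a : K) ∧
      (r ∈ P ↔ a ∈ P))
    (D : ValuationSubring K) (hkD : ∀ c : k, algebraMap k K c ∈ D) (hdvr : IsDiscreteValuationRing D)
    (hft : ∃ B : Subalgebra k K, B.FG ∧ B.toSubring ≤ D.toSubring ∧
      ∀ x : K, x ∈ D → ∃ b s : K, b ∈ B ∧ s ∈ B ∧ s ∉ D.nonunits ∧ x * s = b)
    (hle : R.toSubring ≤ D.toSubring) (hunit : ∀ s : R.toSubring, s ∉ P → (s : K) ∉ D.nonunits)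
    (hcon : ∀ r : R.toSubring, r ∈ P → τ (r : K) ∈ D.nonunits)
    (hesc : ∃ s : R.toSubring, s ∈ P ∧ (s : K) ∉ D.nonunits)
    (hnr : ¬ (∃ (L : Subfield (IsLocalRing.ResidueField D)) (t : IsLocalRing.ResidueField D),
      (∀ c : k, IsLocalRing.residue D ⟨algebraMap k K c, hkD c⟩ ∈ L) ∧
      (∀ f : Polynomial L, f ≠ 0 → Polynomial.eval₂ L.subtype t f ≠ 0) ∧
      (∀ x : IsLocalRing.ResidueField D, ∃ f g : Polynomial L, Polynomial.eval₂ L.subtype t g ≠ 0 ∧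
        x * Polynomial.eval₂ L.subtype t g = Polynomial.eval₂ L.subtype t f))) :
    Set.Infinite {W : ValuationSubring K | ∃ hk : (∀ c : k, algebraMap k K c ∈ W), IsDiscreteValuationRing W ∧ (∃ B : Subalgebra k K, B.FG ∧ B.toSubring ≤ W.toSubring ∧ ∀ x : K, x ∈ W → ∃ b s : K, b ∈ B ∧ s ∈ B ∧ s ∉ W.nonunits ∧ x * s = b) ∧ (∃ h : R.toSubring ≤ W.toSubring, ¬ IsRegularLocalRing (Localization.AtPrime (Ideal.comap (Subring.inclusion h) (IsLocalRing.maximalIdeal W)))) ∧ ¬ (∃ (L : Subfield (IsLocalRing.ResidueField W)) (t : IsLocalRing.ResidueField W), (∀ c : k, IsLocalRing.residue W ⟨algebraMap k K c, hk c⟩ ∈ L) ∧ (∀ f : Polynomial L, f ≠ 0 → Polynomial.eval₂ L.subtype t f ≠ 0) ∧ (∀ x : IsLocalRing.ResidueField W, ∃ f g : Polynomial L, Polynomial.eval₂ L.subtype t g ≠ 0 ∧ x * Polynomial.eval₂ L.subtype t g = Polynomial.eval₂ L.subtype t f))} := by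
  -- the orbit of `D` under `W ↦ W.comap τ`
  let f : ℕ → ValuationSubring K := fun n => D.comap ((τ ^ n : K ≃+* K) : K →+* K)
  have hf0 : f 0 = D := by
    ext x
    simp only [f, ValuationSubring.mem_comap]
    rfl
  have hfsucc : ∀ n : ℕ, f (n + 1) = (f n).comap (τ : K →+* K) := by
    intro n
    ext x
    simp only [f, ValuationSubring.mem_comap, pow_succ]
    rfl
  -- the invariant carried along the orbit
  have hall : ∀ n : ℕ, ∃ hk : (∀ c : k, algebraMap k K c ∈ f n),
      IsDiscreteValuationRing (f n) ∧
      (∃ B : Subalgebra k K, B.FG ∧ B.toSubring ≤ (f n).toSubring ∧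
        ∀ x : K, x ∈ f n → ∃ b s : K, b ∈ B ∧ s ∈ B ∧ s ∉ (f n).nonunits ∧ x * s = b) ∧
      R.toSubring ≤ (f n).toSubring ∧
      (∀ s : R.toSubring, s ∉ P → (s : K) ∉ (f n).nonunits) ∧
      (∀ r : R.toSubring, r ∈ P → τ (r : K) ∈ (f n).nonunits) ∧
      ¬ (∃ (L : Subfield (IsLocalRing.ResidueField (f n))) (t : IsLocalRing.ResidueField (f n)),
          (∀ c : k, IsLocalRing.residue (f n) ⟨algebraMap k K c, hk c⟩ ∈ L) ∧
          (∀ g : Polynomial L, g ≠ 0 → Polynomial.eval₂ L.subtype t g ≠ 0) ∧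
          (∀ x : IsLocalRing.ResidueField (f n), ∃ g h : Polynomial L,
            Polynomial.eval₂ L.subtype t h ≠ 0 ∧
              x * Polynomial.eval₂ L.subtype t h = Polynomial.eval₂ L.subtype t g)) := by
    intro n
    induction n with
    | zero =>
      rw [hf0]
      exact ⟨hkD, hdvr, hft, hle, hunit, hcon, hnr⟩
    | succ n ih =>
      obtain ⟨hk, hdvr', hft', hle', hunit', hcon', hnr'⟩ := ih
      obtain ⟨hk'', hdvr'', hft'', hle'', hunit'', -, hcon''⟩ :=
        stub_transportLocal k K R P τ ι hsemi hloc (f n) (f (n + 1)) (hfsucc n) hk hdvr' hft' hle'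
          hunit' hcon'
      exact ⟨hk'', hdvr'', hft'', hle'', hunit'', hcon'',
        stub_transportNonRuled k K τ ι hsemi (f n) (f (n + 1)) (hfsucc n) hk hk'' hnr'⟩
  -- from index 1 on, the members lie in the witness set of the crux
  have hmem : ∀ n : ℕ, ∃ hk : (∀ c : k, algebraMap k K c ∈ f (n + 1)),
      IsDiscreteValuationRing (f (n + 1)) ∧
      (∃ B : Subalgebra k K, B.FG ∧ B.toSubring ≤ (f (n + 1)).toSubring ∧
        ∀ x : K, x ∈ f (n + 1) → ∃ b s : K, b ∈ B ∧ s ∈ B ∧ s ∉ (f (n + 1)).nonunits ∧ x * s = b) ∧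
      (∃ h : R.toSubring ≤ (f (n + 1)).toSubring, ¬ IsRegularLocalRing (Localization.AtPrime
        (Ideal.comap (Subring.inclusion h) (IsLocalRing.maximalIdeal (f (n + 1)))))) ∧
      ¬ (∃ (L : Subfield (IsLocalRing.ResidueField (f (n + 1))))
          (t : IsLocalRing.ResidueField (f (n + 1))),
          (∀ c : k, IsLocalRing.residue (f (n + 1)) ⟨algebraMap k K c, hk c⟩ ∈ L) ∧
          (∀ g : Polynomial L, g ≠ 0 → Polynomial.eval₂ L.subtype t g ≠ 0) ∧
          (∀ x : IsLocalRing.ResidueField (f (n + 1)), ∃ g h : Polynomial L,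
            Polynomial.eval₂ L.subtype t h ≠ 0 ∧
              x * Polynomial.eval₂ L.subtype t h = Polynomial.eval₂ L.subtype t g)) := by
    intro n
    obtain ⟨hk, hdvr', hft', hle', hunit', hcon', hnr'⟩ := hall n
    obtain ⟨-, -, -, hle'', -, hdom'', -⟩ :=
      stub_transportLocal k K R P τ ι hsemi hloc (f n) (f (n + 1)) (hfsucc n) hk hdvr' hft' hle'
        hunit' hcon'
    obtain ⟨hk₁, hdvr₁, hft₁, -, -, -, hnr₁⟩ := hall (n + 1)
    exact ⟨hk₁, hdvr₁, hft₁,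
      ⟨hle'', stub_transportSingular K R.toSubring P hsing (f (n + 1)) hle'' hdom''⟩, hnr₁⟩
  -- injectivity of the shifted orbit (the escaping unit)
  have hinj : Function.Injective f :=
    stub_escapeInjective K R.toSubring P τ hloc D hle hunit hcon hesc
  have hinj' : Function.Injective (fun n : ℕ => f (n + 1)) :=
    fun m n h => Nat.succ_injective (hinj h)
  exact Set.infinite_of_injective_forall_mem hinj' hmem

/-- **A contracted-divisor germ forbids resolution of the model.**  Under the hypotheses of
`contractedDivisor_witnessSet_infinite`, with `R` finitely generated and `Frac R = K`,
`Spec R` has NO resolution of singularities: a resolution would make the witness set over `R` finite by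
the route's kills `NonRuledCofinite` (stmt-18076, proved) and `RegularModelRuled` (stmt-18077, Abhyankar
1956 Prop. 4, proved). [folklore] -/
theorem not_hasResolution_of_contractedDivisor (k K : Type) [Field k] [Field K] [Algebra k K]
    (R : Subalgebra k K) (hR : R.FG) (hfr : IsFractionRing R K) (P : Ideal R.toSubring) [P.IsPrime]
    (hsing : ¬ IsRegularLocalRing (Localization.AtPrime P)) (τ : K ≃+* K) (ι : k ≃+* k)
    (hsemi : ∀ c : k, τ (algebraMap k K c) = algebraMap k K (ι c))
    (hloc : ∀ r : R.toSubring, ∃ a s : R.toSubring, s ∉ P ∧ τ (r : K) * (s : K) = (a : K) ∧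
      (r ∈ P ↔ a ∈ P))
    (D : ValuationSubring K) (hkD : ∀ c : k, algebraMap k K c ∈ D) (hdvr : IsDiscreteValuationRing D)
    (hft : ∃ B : Subalgebra k K, B.FG ∧ B.toSubring ≤ D.toSubring ∧
      ∀ x : K, x ∈ D → ∃ b s : K, b ∈ B ∧ s ∈ B ∧ s ∉ D.nonunits ∧ x * s = b)
    (hle : R.toSubring ≤ D.toSubring) (hunit : ∀ s : R.toSubring, s ∉ P → (s : K) ∉ D.nonunits)
    (hcon : ∀ r : R.toSubring, r ∈ P → τ (r : K) ∈ D.nonunits)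
    (hesc : ∃ s : R.toSubring, s ∈ P ∧ (s : K) ∉ D.nonunits)
    (hnr : ¬ (∃ (L : Subfield (IsLocalRing.ResidueField D)) (t : IsLocalRing.ResidueField D),
      (∀ c : k, IsLocalRing.residue D ⟨algebraMap k K c, hkD c⟩ ∈ L) ∧
      (∀ f : Polynomial L, f ≠ 0 → Polynomial.eval₂ L.subtype t f ≠ 0) ∧
      (∀ x : IsLocalRing.ResidueField D, ∃ f g : Polynomial L, Polynomial.eval₂ L.subtype t g ≠ 0 ∧
        x * Polynomial.eval₂ L.subtype t g = Polynomial.eval₂ L.subtype t f))) :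
    ¬ Scheme.HasResolution (Spec (CommRingCat.of R)) := by
  intro hres
  have hinf := contractedDivisor_witnessSet_infinite k K R P hsing τ ι hsemi hloc D hkD hdvr hft hle
    hunit hcon hesc hnr
  have hfin := RuledResiduesNonRuledCofinite.nonRuledCofinite_proof k K R hR hfr hres
  apply hinf
  refine hfin.subset ?_
  intro W hWmem
  obtain ⟨hk, hdvrW, hftW, hsingW, hnrW⟩ := hWmem
  refine ⟨hk, hdvrW, hftW, hsingW, ?_⟩
  rintro ⟨A, hAfg, hAfr, h', hreg, hdim⟩
  exact hnrW (RuledResiduesRegularModelRuled.regularModelRuled_proof k K W hk hdvrW hftW A hAfg hAfr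
    h' hreg hdim)

/-- **The hunt lives in dimension `≥ 4`.**  Under the named fact `CossartPiltant2019` (resolution of
reduced separated finite-type schemes of dimension `≤ 3` over a field), a contracted-divisor germ cannot
sit on an affine model `Spec R` of topological Krull dimension `≤ 3`: `Spec R → Spec k` is affine (hence
separated and quasi-compact), of finite type (`R` finitely generated) and reduced (`R ⊆ K` is a domain),
so it would have a resolution, contradicting `not_hasResolution_of_contractedDivisor`.
[cite: CossartPiltant2019, Thm. 1.1] -/
theorem contractedDivisor_not_dim_le_three (hCP : CossartPiltant2019.{0}) (k K : Type) [Field k]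
    [Field K] [Algebra k K]
    (R : Subalgebra k K) (hR : R.FG) (hfr : IsFractionRing R K) (P : Ideal R.toSubring) [P.IsPrime]
    (hsing : ¬ IsRegularLocalRing (Localization.AtPrime P)) (τ : K ≃+* K) (ι : k ≃+* k)
    (hsemi : ∀ c : k, τ (algebraMap k K c) = algebraMap k K (ι c))
    (hloc : ∀ r : R.toSubring, ∃ a s : R.toSubring, s ∉ P ∧ τ (r : K) * (s : K) = (a : K) ∧
      (r ∈ P ↔ a ∈ P))
    (D : ValuationSubring K) (hkD : ∀ c : k, algebraMap k K c ∈ D) (hdvr : IsDiscreteValuationRing D)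
    (hft : ∃ B : Subalgebra k K, B.FG ∧ B.toSubring ≤ D.toSubring ∧
      ∀ x : K, x ∈ D → ∃ b s : K, b ∈ B ∧ s ∈ B ∧ s ∉ D.nonunits ∧ x * s = b)
    (hle : R.toSubring ≤ D.toSubring) (hunit : ∀ s : R.toSubring, s ∉ P → (s : K) ∉ D.nonunits)
    (hcon : ∀ r : R.toSubring, r ∈ P → τ (r : K) ∈ D.nonunits)
    (hesc : ∃ s : R.toSubring, s ∈ P ∧ (s : K) ∉ D.nonunits)
    (hnr : ¬ (∃ (L : Subfield (IsLocalRing.ResidueField D)) (t : IsLocalRing.ResidueField D),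
      (∀ c : k, IsLocalRing.residue D ⟨algebraMap k K c, hkD c⟩ ∈ L) ∧
      (∀ f : Polynomial L, f ≠ 0 → Polynomial.eval₂ L.subtype t f ≠ 0) ∧
      (∀ x : IsLocalRing.ResidueField D, ∃ f g : Polynomial L, Polynomial.eval₂ L.subtype t g ≠ 0 ∧
        x * Polynomial.eval₂ L.subtype t g = Polynomial.eval₂ L.subtype t f))) :
    ¬ topologicalKrullDim (Spec (CommRingCat.of R)) ≤ 3 := by
  intro hdim
  haveI : Algebra.FiniteType k R := R.fg_iff_finiteType.mp hR
  let f : Spec (.of R) ⟶ Spec (.of k) := Spec.map (CommRingCat.ofHom (algebraMap k R))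
  haveI : LocallyOfFiniteType f :=
    (HasRingHomProperty.Spec_iff (P := @LocallyOfFiniteType)).mpr (RingHom.finiteType_algebraMap.mpr ‹_›)
  have hres : Scheme.HasResolution (Spec (CommRingCat.of R)) :=
    hCP k (Spec (.of R)) f inferInstance inferInstance inferInstance inferInstance hdim
  exact not_hasResolution_of_contractedDivisor k K R hR hfr P hsing τ ι hsemi hloc D hkD hdvr hft hle
    hunit hcon hesc hnr hres

/-- **Glue: the registered stub `stub_contractedDivisorGerm` (signature verbatim) implies the crux**
`RuledResidues.NonRuledDivisors` — companion of `nonRuledDivisors_of_orbitGerm` for line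
`contracted-divisor`. [folklore] -/
theorem nonRuledDivisors_of_contractedDivisorGerm : (∃ p : ℕ, p.Prime ∧ ∃ (k K : Type) (_ : Field k) (_ : CharP k p) (_ : Field K) (_ : Algebra k K), ∃ R : Subalgebra k K, R.FG ∧ IsFractionRing R K ∧ ∃ (P : Ideal R.toSubring) (_ : P.IsPrime), ¬ IsRegularLocalRing (Localization.AtPrime P) ∧ ∃ (τ : K ≃+* K) (ι : k ≃+* k), (∀ c : k, τ (algebraMap k K c) = algebraMap k K (ι c)) ∧ (∀ r : R.toSubring, ∃ a s : R.toSubring, s ∉ P ∧ τ (r : K) * (s : K) = (a : K) ∧ (r ∈ P ↔ a ∈ P)) ∧ ∃ (D : ValuationSubring K) (hkD : ∀ c : k, algebraMap k K c ∈ D), IsDiscreteValuationRing D ∧ (∃ B : Subalgebra k K, B.FG ∧ B.toSubring ≤ D.toSubring ∧ ∀ x : K, x ∈ D → ∃ b s : K, b ∈ B ∧ s ∈ B ∧ s ∉ D.nonunits ∧ x * s = b) ∧ R.toSubring ≤ D.toSubring ∧ (∀ s : R.toSubring, s ∉ P → (s : K) ∉ D.nonunits) ∧ (∀ r : R.toSubring,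 r ∈ P → τ (r : K) ∈ D.nonunits) ∧ (∃ s : R.toSubring, s ∈ P ∧ (s : K) ∉ D.nonunits) ∧ ¬ (∃ (L : Subfield (IsLocalRing.ResidueField D)) (t : IsLocalRing.ResidueField D), (∀ c : k, IsLocalRing.residue D ⟨algebraMap k K c, hkD c⟩ ∈ L) ∧ (∀ f : Polynomial L, f ≠ 0 → Polynomial.eval₂ L.subtype t f ≠ 0) ∧ (∀ x : IsLocalRing.ResidueField D, ∃ f g : Polynomial L, Polynomial.eval₂ L.subtype t g ≠ 0 ∧ x * Polynomial.eval₂ L.subtype t g = Polynomial.eval₂ L.subtype t f))) → Summit.ResolutionOfSingularities.ResolutionOfSingularities.Theses.RuledResidues.NonRuledDivisors := by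
  intro h
  obtain ⟨p, hp, k, K, instk, instc, instK, instA, R, hRfg, hfrac, P, instP, hsing, τ, ι, hsemi,
    hloc, D, hkD, hdvr, hft, hle, hunit, hcon, hesc, hnr⟩ := h
  haveI := instP
  exact ⟨p, hp, k, K, instk, instc, instK, instA, R, hRfg, hfrac,
    contractedDivisor_witnessSet_infinite k K R P hsing τ ι hsemi hloc D hkD hdvr hft hle hunit hcon
      hesc hnr⟩

/-- **… and refutes the summit**: a contracted-divisor germ is, via the proved kills of route
`RuledResidues` (`closes`), a formal counterexample to resolution of singularities in positive
characteristic. [folklore] -/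
theorem not_resolutionOfSingularities_of_contractedDivisorGerm
    (h : ∃ p : ℕ, p.Prime ∧ ∃ (k K : Type) (_ : Field k) (_ : CharP k p) (_ : Field K) (_ : Algebra k K), ∃ R : Subalgebra k K, R.FG ∧ IsFractionRing R K ∧ ∃ (P : Ideal R.toSubring) (_ : P.IsPrime), ¬ IsRegularLocalRing (Localization.AtPrime P) ∧ ∃ (τ : K ≃+* K) (ι : k ≃+* k), (∀ c : k, τ (algebraMap k K c) = algebraMap k K (ι c)) ∧ (∀ r : R.toSubring, ∃ a s : R.toSubring, s ∉ P ∧ τ (r : K) * (s : K) = (a : K) ∧ (r ∈ P ↔ a ∈ P)) ∧ ∃ (D : ValuationSubring K) (hkD : ∀ c : k, algebraMap k K c ∈ D), IsDiscreteValuationRing D ∧ (∃ B : Subalgebra k K, B.FG ∧ B.toSubring ≤ D.toSubring ∧ ∀ x : K, x ∈ D → ∃ b s : K, b ∈ B ∧ s ∈ B ∧ s ∉ D.nonunits ∧ x * s = b) ∧ R.toSubring ≤ D.toSubring ∧ (∀ s : R.toSubring, s ∉ P → (s : K) ∉ D.nonunits) ∧ (∀ r : R.toSubring, r ∈ P → τ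 (r : K) ∈ D.nonunits) ∧ (∃ s : R.toSubring, s ∈ P ∧ (s : K) ∉ D.nonunits) ∧ ¬ (∃ (L : Subfield (IsLocalRing.ResidueField D)) (t : IsLocalRing.ResidueField D), (∀ c : k, IsLocalRing.residue D ⟨algebraMap k K c, hkD c⟩ ∈ L) ∧ (∀ f : Polynomial L, f ≠ 0 → Polynomial.eval₂ L.subtype t f ≠ 0) ∧ (∀ x : IsLocalRing.ResidueField D, ∃ f g : Polynomial L, Polynomial.eval₂ L.subtype t g ≠ 0 ∧ x * Polynomial.eval₂ L.subtype t g = Polynomial.eval₂ L.subtype t f))) :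
    ¬ _root_.ResolutionOfSingularities :=
  closes (nonRuledDivisors_of_contractedDivisorGerm h)
    RuledResiduesRegularModelRuled.regularModelRuled_proof
    RuledResiduesNonRuledCofinite.nonRuledCofinite_proof

end Summit.ResolutionOfSingularities.ResolutionOfSingularities.Theorems

end
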